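import Mathlib
import Summits.PneNP.PneNP.Theses.NegLimited
import Summits.PneNP.PneNP.Theorems.NegLimitedDoorAMCover
import Summits.PneNP.PneNP.Theorems.NegLimitedDoorNullMass
import Literature.Computability.Complexity.Rossman2008CliqueProofs
import HarnessLib

/-!
# Route NegLimited — door glue `DoorOfPlantedClique` (line `correlation-door`, stub 5; rung F-N1/p3, ROUND-8 §B.3)

Registered stub `stub_doorOfPlantedClique` of the skeleton `correlation-door` on the door item
`NegLimited.NeglimitedEpsLogNegationsR` (stmt-PneNP-19860; HOME/pnp-ideate-p3/r9/Skeleton-R9-door.lean):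
the ASSEMBLED IMPLICATION (asymptotic arithmetic only)

  `AMCoverMonPairs → PlantedNegationTransfer → PlantedQuartCliqueNullMass → QuartCliqueSlicesNP →
   PlantedCliqueMonotoneAdvantageQuart → NeglimitedEpsLogNegationsR`.

With the crux's `ε₀`, take door-`ε := ε₀/3`, lengths `n = m·m`, NOT budget
`b = ⌊(ε₀/3)·log₂ n⌋ ≤ (2ε₀/3)·log₂ m`.  If a De Morgan circuit `D` of size `≤ n^k = m^{2k}` with `≤ b`
NOT gates computed `CLIQUE(m, ⌊m^{1/4}⌋)`, then by `PlantedNegationTransfer` some `g` — constant (flip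
probability `0`) or computed by a monotone circuit of size `≤ m^{2k}` (flip probability `≤ m^{-ε₀}` by
the crux at exponent `c = 2k`) — would satisfy `½ ≤ Pr[no ⌊m^{1/4}⌋-clique] ≤ (2^{b+1} − 1)·m^{-ε₀}
< 2·m^{2ε₀/3}·m^{-ε₀} = 2·m^{-ε₀/3} ≤ ½` for large `m` — impossible.  `QuartCliqueSlicesNP` transports
the resulting size bound `n^k + 1` to the (monotone) slice of its NP language at `n = m²`, and the
squares are cofinal, so the door statement holds `∃ᶠ n`.  The statements of the five hypotheses are the
§B items of turnkey-R8/add_items_door_v2.json VERBATIM (`AMCoverMonPairs`, `PlantedQuartCliqueNullMass`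
from the landed stub files; the other three declared here).
-/

set_option linter.dupNamespace false -- `Summit.PneNP.PneNP.…`: summit = sub-problem name (D-0017 single-conjunct layout)

namespace Summit.PneNP.PneNP.Theorems.NegLimitedDoor

open Finset Filter
open Literature.Computability.Complexity

/-! ### The remaining §B statements (verbatim) -/

/-- support `PlantedNegationTransfer` (R8-T2, Rossman CCC'15 L1.3/L3.2 specialised to the planted coupling;
statement verbatim from turnkey-R8/add_items_door_v2.json). -/
def PlantedNegationTransfer : Prop :=
  ∀ (m k t : ℕ) (C : Literature.Computability.Complexity.Circuit ↥(⊤ : SimpleGraph (Fin m)).edgeSet), k ≤ m → C.IsOver Literature.Computability.Complexity.deMorganBasis → C.Computes (Literature.Computability.Complexity.cliqueFn m k) → C.negationCount ≤ t → ∃ g : (↥(⊤ : SimpleGraph (Fin m)).edgeSet → Bool) → Bool, ((∃ b : Bool, ∀ x, g x = b) ∨ ∃ M : Literature.Computability.Complexity.Circuit ↥(⊤ : SimpleGraph (Fin m)).edgeSet, M.IsOver Literature.Computability.Complexity.monotoneBasis ∧ M.size ≤ C.size ∧ M.Computes g) ∧ Literature.Computability.Complexity.gnpProb m (1 / 2)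 (Finset.univ.filter fun x => Literature.Computability.Complexity.cliqueFn m k x = false) ≤ ((2:ℝ) ^ (t + 1) - 1) * Literature.Computability.Complexity.plantFlipProb m k (1 / 2) g

/-- crux `PlantedCliqueMonotoneAdvantageQuart` (R8-C, the OPEN research crux; statement verbatim). -/
def PlantedCliqueMonotoneAdvantageQuart : Prop :=
  ∃ ε : ℝ, 0 < ε ∧ ∀ c : ℕ, ∀ᶠ m : ℕ in Filter.atTop, ∀ M : Literature.Computability.Complexity.Circuit ↥(⊤ : SimpleGraph (Fin m)).edgeSet, M.IsOver Literature.Computability.Complexity.monotoneBasis → M.size ≤ m ^ c → Literature.Computability.Complexity.plantFlipProb m (Nat.sqrt (Nat.sqrt m)) (1 / 2) M.eval ≤ (m : ℝ) ^ (-ε)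

/-- support `QuartCliqueSlicesNP` (R8-P; statement verbatim). -/
def QuartCliqueSlicesNP : Prop :=
  ∃ L ∈ Literature.Computability.Complexity.Nondeterministic.NP, ∀ m : ℕ, 16 ≤ m → Monotone (L.sliceFn (m * m)) ∧ ∀ b s : ℕ, (∀ D : Literature.Computability.Complexity.Circuit ↥(⊤ : SimpleGraph (Fin m)).edgeSet, D.IsOver Literature.Computability.Complexity.deMorganBasis → D.Computes (Literature.Computability.Complexity.cliqueFn m (Nat.sqrt (Nat.sqrt m))) → D.negationCount ≤ b → s ≤ D.size) → s ≤ Literature.Computability.Complexity.negLimitedSizeOver Literature.Computability.Complexity.deMorganBasis b (L.sliceFn (m * m))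

/-- support `DoorOfPlantedClique` (R8-D, the glue of the split; statement verbatim). -/
def DoorOfPlantedClique : Prop :=
  AMCoverMonPairs → PlantedNegationTransfer → PlantedQuartCliqueNullMass → QuartCliqueSlicesNP → PlantedCliqueMonotoneAdvantageQuart → Summit.PneNP.PneNP.Theses.NegLimited.NeglimitedEpsLogNegationsR

/-! ### Helpers -/

/-- A constant function never flips under planting: `plantFlipProb` of a constant is `0`. -/
theorem plantFlipProb_of_const {m k : ℕ} (q : ℝ) {g : (↥(⊤ : SimpleGraph (Fin m)).edgeSet → Bool) → Bool}
    {b : Bool} (hg : ∀ x, g x = b) : plantFlipProb m k q g = 0 := by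
  unfold plantFlipProb
  rw [sum_eq_zero fun A _ => sum_eq_zero fun x _ => by rw [if_pos (by rw [hg, hg])], mul_zero]

/-- The NOT budget at length `n = m²`: `2^{⌊(ε/3)·log₂(m·m)⌋₊ + 1} ≤ 2·m^{2ε/3}` for `m ≥ 1`, `ε ≥ 0`. -/
theorem two_pow_budget_le {ε : ℝ} (hε : 0 ≤ ε) {m : ℕ} (hm : 1 ≤ m) :
    (2 : ℝ) ^ (⌊ε / 3 * Real.logb 2 ((m * m : ℕ) : ℝ)⌋₊ + 1) ≤ 2 * (m : ℝ) ^ (2 * ε / 3) := by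
  have hm0 : (0 : ℝ) < m := by exact_mod_cast hm
  have hmm : ((m * m : ℕ) : ℝ) = (m : ℝ) ^ (2 : ℕ) := by push_cast; ring
  have hlog : Real.logb 2 ((m * m : ℕ) : ℝ) = 2 * Real.logb 2 m := by
    rw [hmm, Real.logb_pow]
    push_cast
    ring
  have hlog0 : 0 ≤ Real.logb 2 (m : ℝ) :=
    Real.logb_nonneg one_lt_two (by exact_mod_cast hm)
  have hfloor : (⌊ε / 3 * Real.logb 2 ((m * m : ℕ) : ℝ)⌋₊ : ℝ) ≤ 2 * ε / 3 * Real.logb 2 m := by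
    have h0 : 0 ≤ ε / 3 * Real.logb 2 ((m * m : ℕ) : ℝ) := by rw [hlog]; positivity
    calc (⌊ε / 3 * Real.logb 2 ((m * m : ℕ) : ℝ)⌋₊ : ℝ) ≤ ε / 3 * Real.logb 2 ((m * m : ℕ) : ℝ) :=
          Nat.floor_le h0
      _ = 2 * ε / 3 * Real.logb 2 m := by rw [hlog]; ring
  have hpow : (2 : ℝ) ^ (⌊ε / 3 * Real.logb 2 ((m * m : ℕ) : ℝ)⌋₊ : ℝ) ≤ (m : ℝ) ^ (2 * ε / 3) := by
    calc (2 : ℝ) ^ (⌊ε / 3 * Real.logb 2 ((m * m : ℕ) : ℝ)⌋₊ : ℝ)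
        ≤ (2 : ℝ) ^ (2 * ε / 3 * Real.logb 2 m) := Real.rpow_le_rpow_of_exponent_le one_le_two hfloor
      _ = ((2 : ℝ) ^ (Real.logb 2 m)) ^ (2 * ε / 3) := by
          rw [← Real.rpow_mul (by norm_num), mul_comm]
      _ = (m : ℝ) ^ (2 * ε / 3) := by rw [Real.rpow_logb two_pos (by norm_num) hm0]
  calc (2 : ℝ) ^ (⌊ε / 3 * Real.logb 2 ((m * m : ℕ) : ℝ)⌋₊ + 1)
      = 2 * (2 : ℝ) ^ (⌊ε / 3 * Real.logb 2 ((m * m : ℕ) : ℝ)⌋₊ : ℝ) := by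
        rw [pow_succ, mul_comm, Real.rpow_natCast]
    _ ≤ 2 * (m : ℝ) ^ (2 * ε / 3) := by linarith

/-- Eventually `2·m^{-ε/3} < 1/2` (for `ε > 0`). -/
theorem eventually_two_mul_rpow_neg_lt {ε : ℝ} (hε : 0 < ε) :
    ∀ᶠ m : ℕ in atTop, 2 * (m : ℝ) ^ (-(ε / 3)) < 1 / 2 := by
  have ht : Tendsto (fun m : ℕ => (m : ℝ) ^ (ε / 3)) atTop atTop :=
    (tendsto_rpow_atTop (by positivity)).comp tendsto_natCast_atTop_atTop
  filter_upwards [ht.eventually_ge_atTop 5, eventually_ge_atTop 1] with m hm hm1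
  have hm0 : (0 : ℝ) < m := by exact_mod_cast hm1
  have hpos : 0 < (m : ℝ) ^ (ε / 3) := Real.rpow_pos_of_pos hm0 _
  rw [Real.rpow_neg hm0.le]
  rw [show (2 : ℝ) * ((m : ℝ) ^ (ε / 3))⁻¹ = 2 / (m : ℝ) ^ (ε / 3) by ring]
  rw [div_lt_iff₀ hpos]
  linarith

/-! ### The stub -/

/-- **Stub 5 of line `correlation-door` PROVED** (`DoorOfPlantedClique`, by name): the five §B inputs
(two of them the landed stubs `AMCoverMonPairs`, `PlantedQuartCliqueNullMass`; the transfer, the slices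
and the OPEN crux as hypotheses) imply the door `NeglimitedEpsLogNegationsR` with `ε = ε₀/3` along the
squares `n = m²`. -/
theorem stub_doorOfPlantedClique : DoorOfPlantedClique := by
  intro _hAM hPT hNull hSl hCrux
  obtain ⟨ε₀, hε₀, hcrux⟩ := hCrux
  obtain ⟨L, hLNP, hL⟩ := hSl
  refine ⟨L, hLNP, ε₀ / 3, by positivity, fun k => ?_⟩
  -- everything happens eventually in `m`, at the length `n = m * m`
  have hmain : ∀ᶠ m : ℕ in atTop, Monotone (L.sliceFn (m * m)) ∧
      (m * m) ^ k < negLimitedSizeOver deMorganBasis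
        ⌊ε₀ / 3 * Real.logb 2 ((m * m : ℕ) : ℝ)⌋₊ (L.sliceFn (m * m)) := by
    filter_upwards [eventually_ge_atTop 16, hNull, hcrux (2 * k),
      eventually_two_mul_rpow_neg_lt hε₀] with m hm16 hnull hcr hsmall
    obtain ⟨hmono, htransfer⟩ := hL m hm16
    refine ⟨hmono, ?_⟩
    set κ := Nat.sqrt (Nat.sqrt m) with hκ
    set b := ⌊ε₀ / 3 * Real.logb 2 ((m * m : ℕ) : ℝ)⌋₊ with hb
    have hκm : κ ≤ m := (Nat.sqrt_le_self _).trans (Nat.sqrt_le_self _)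
    have hm1 : 1 ≤ m := by omega
    have hm0 : (0 : ℝ) < m := by exact_mod_cast hm1
    -- every De Morgan circuit with `≤ b` NOTs computing the clique function is large
    have hbig : ∀ D : Circuit ↥(⊤ : SimpleGraph (Fin m)).edgeSet, D.IsOver deMorganBasis →
        D.Computes (cliqueFn m κ) → D.negationCount ≤ b → (m * m) ^ k + 1 ≤ D.size := by
      intro D hD hcomp hneg
      by_contra hlt
      have hsize : D.size ≤ (m * m) ^ k := by omega
      have hsize' : D.size ≤ m ^ (2 * k) := by
        have : m ^ (2 * k) = (m * m) ^ k := by rw [pow_mul, sq]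
        rw [this]
        exact hsize
      obtain ⟨g, hg, hbound⟩ := hPT m κ b D hκm hD hcomp hneg
      -- the flip probability of `g` is small
      have hflip : plantFlipProb m κ (1 / 2) g ≤ (m : ℝ) ^ (-ε₀) := by
        rcases hg with ⟨c, hc⟩ | ⟨M, hM, hMsize, hMg⟩
        · rw [plantFlipProb_of_const (1 / 2) hc]
          exact Real.rpow_nonneg hm0.le _
        · rw [← plantFlipProb_congr hMg]
          exact hcr M hM (hMsize.trans hsize')
      -- `1/2 ≤ (2^{b+1} - 1) m^{-ε₀} < 1/2`
      have hcoef : (0 : ℝ) ≤ (2 : ℝ) ^ (b + 1) - 1 := by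
        have : (1 : ℝ) ≤ (2 : ℝ) ^ (b + 1) := one_le_pow₀ (by norm_num)
        linarith
      have h1 : (1 / 2 : ℝ) ≤ ((2 : ℝ) ^ (b + 1) - 1) * (m : ℝ) ^ (-ε₀) :=
        hnull.trans (hbound.trans (mul_le_mul_of_nonneg_left hflip hcoef))
      have h2 : ((2 : ℝ) ^ (b + 1) - 1) * (m : ℝ) ^ (-ε₀) < 1 / 2 := by
        have hbud := two_pow_budget_le hε₀.le hm1
        have hmε : 0 < (m : ℝ) ^ (-ε₀) := Real.rpow_pos_of_pos hm0 _
        calc ((2 : ℝ) ^ (b + 1) - 1) * (m : ℝ) ^ (-ε₀)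
            ≤ (2 * (m : ℝ) ^ (2 * ε₀ / 3)) * (m : ℝ) ^ (-ε₀) :=
              mul_le_mul_of_nonneg_right (by linarith) hmε.le
          _ = 2 * (m : ℝ) ^ (-(ε₀ / 3)) := by
              rw [mul_assoc, ← Real.rpow_add hm0]
              ring_nf
          _ < 1 / 2 := hsmall
      linarith
    exact htransfer b ((m * m) ^ k + 1) hbig
  -- the squares are cofinal: `∃ᶠ n`
  rw [Filter.frequently_atTop]
  intro a
  obtain ⟨M, hM⟩ := Filter.eventually_atTop.1 hmain
  refine ⟨max a (max M 1) * max a (max M 1), ?_, hM _ (le_trans (le_max_left _ _) (le_max_right _ _))⟩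
  calc a ≤ max a (max M 1) := le_max_left _ _
    _ = max a (max M 1) * 1 := (mul_one _).symm
    _ ≤ max a (max M 1) * max a (max M 1) :=
        Nat.mul_le_mul_left _ (le_trans (le_max_right _ _) (le_max_right _ _))

end Summit.PneNP.PneNP.Theorems.NegLimitedDoor
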